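import Mathlib
import HarnessLib
import Summits.NavierStokesRegularity.NavierStokesRegularity.Theorems.PoloidalWindowDoorPoloidalWindowRigidityClebsch
import Summits.NavierStokesRegularity.NavierStokesRegularity.Theorems.PoloidalWindowDoorPoloidalWindowRigidityClebschBernoulli
import Summits.NavierStokesRegularity.NavierStokesRegularity.Theorems.PoloidalWindowDoorPoloidalWindowRigidityClebschDynamics

/-!
# Route `PoloidalWindowDoor` (staged, nsreg-p1), crux `PoloidalWindowRigidity` (K2) — the ψ-equation of a poloidal
# profile: `∇_h(∂ₜψ + v·∇ψ − Δψ − v₂∂₂ψ + ∂₂B) = 0`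

Cell ns-regularity-ideate, seat p7 (lead on K2; route-directed support for the open stub `stub_nonflatLiouville`,
to be landed `--supports <PoloidalWindowRigidity item>` once the route is born); fifth Clebsch file, assembling
`…Clebsch` (frozen bracket), `…ClebschBernoulli` (`∇_h B = v₂∇_hψ`, `∂ᵢ(v₂∂₂ψ − ∂₂B) = ∂₂ψ∂ᵢv₂ − ∂₂v₂∂ᵢψ`) and
`…ClebschDynamics` ((E2) literal, `∇_h T = ∂₂ψ∇_hv₂ − ∂₂v₂∇_hψ`, `T = ∂ₜψ + v·∇ψ − Δψ`):

* `clebsch_psi_equation` — under EXACTLY the hypotheses of `stub_nonflatLiouville`, for every `t < 0` there is a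
  smooth Bernoulli potential `B` with `∇_h B = v₂ ∇_h ψ` and **`∇_h(T − (v₂∂₂ψ − ∂₂B)) = 0`**: the stream function
  obeys the transport–diffusion equation `∂ₜψ + v·∇ψ − Δψ = v₂∂₂ψ − ∂₂B + c(x₂, t)` (seat census
  HOME/ns-regularity-ideate-p7/CENSUS-K2G.md §5, where on the generic branch `B = β(ψ;x₂,t)`, `v₂ = β_ψ` and the
  source is `−β_{x₂}(ψ; x₂, t)` — the located UNSIGNED term of the open residue).

WHAT THIS IS NOT: not a claim about Navier–Stokes regularity and not a proof of K2 — kernel bookkeeping for a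
STAGED door route's open stub (bears_on LADDER-NS N0, rung N0-LocalTubeDoorPoloidal).
-/

noncomputable section

-- the summit and its single sub-problem share the name (CONVENTIONS §1), as in every Theorems file
set_option linter.dupNamespace false

namespace Summit.NavierStokesRegularity.NavierStokesRegularity.Theorems.PoloidalWindowDoorPoloidalWindowRigidityClebschPsiEquation

open Set Function MeasureTheory intervalIntegral Filter Topology
open scoped RealInnerProductSpace InnerProductSpace ContDiff Laplacian
open Literature.Analysis Literature.Analysis.FluidPDE
open Literature.Analysis.FluidPDE.VerticalVorticityFree
open Summit.NavierStokesRegularity.NavierStokesRegularity.Theorems.LocalSineTubeDoorProfileAlignedWindowRigidityAncient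
open Summit.NavierStokesRegularity.NavierStokesRegularity.Theorems.PoloidalWindowDoorPoloidalWindowRigidityClebschVorticity
open Summit.NavierStokesRegularity.NavierStokesRegularity.Theorems.PoloidalWindowDoorPoloidalWindowRigidityClebsch
open Summit.NavierStokesRegularity.NavierStokesRegularity.Theorems.PoloidalWindowDoorPoloidalWindowRigidityClebschBernoulli
open Summit.NavierStokesRegularity.NavierStokesRegularity.Theorems.PoloidalWindowDoorPoloidalWindowRigidityClebschDynamics

variable {C : ℝ} {v : ℝ → EuclideanSpace ℝ (Fin 3) → EuclideanSpace ℝ (Fin 3)}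

/-- **The ψ-equation.** Under EXACTLY the hypotheses of `stub_nonflatLiouville` (class, poloidality along `e₂`,
frozen constraint), with the time-dependent line potential `φ` and stream function `ψ`: for every `t < 0` there is a
smooth Bernoulli potential `B` with `∇_h B = v₂ ∇_h ψ` and
`∇_h(∂ₜψ + (v·∇)ψ − Δψ − (v₂ ∂₂ψ − ∂₂B)) = 0` — the source of the transport–diffusion equation for `ψ` is
`v₂∂₂ψ − ∂₂B` up to a function of `(x₂, t)` (census §5: `= −β_{x₂}(ψ; x₂, t)` on the generic branch). -/
theorem clebsch_psi_equation (hrate : HasTypeITimeDecay C v)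
    (hcont : ContinuousOn (uncurry v) (Iio (0 : ℝ) ×ˢ univ))
    (hmild : ∀ s t : ℝ, s < t → t < 0 → ∀ x,
      v t x = UnboundedOperators.heatExtension (v s) (t - s) x - oseenDuhamel 1 s v v t x)
    (hdiv : ∀ t < 0, VectorCalculus.IsDivFree (v t))
    (hpol : ∀ s < 0, ∀ y, ⟪curl (v s) y, EuclideanSpace.single 2 1⟫_ℝ = 0)
    (hfi : ∀ s < 0, ∀ y, ⟪fderiv ℝ (v s) y (curl (v s) y), EuclideanSpace.single 2 1⟫_ℝ = 0)
    {φ ψ : ℝ → EuclideanSpace ℝ (Fin 3) → ℝ}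
    (hφ : φ = fun (t : ℝ) (x : EuclideanSpace ℝ (Fin 3)) =>
      ∫ σ in (0 : ℝ)..1, ⟪v t (σ • (x - x 2 • (EuclideanSpace.single (2 : Fin 3) (1 : ℝ))) +
        x 2 • (EuclideanSpace.single (2 : Fin 3) (1 : ℝ))), x - x 2 • (EuclideanSpace.single (2 : Fin 3) (1 : ℝ))⟫_ℝ)
    (hψ : ψ = fun t y => v t y 2 - fderiv ℝ (φ t) y (EuclideanSpace.single 2 1))
    {t : ℝ} (ht : t < 0) :
    ∃ B : EuclideanSpace ℝ (Fin 3) → ℝ, ContDiff ℝ ∞ B ∧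
      (∀ y, fderiv ℝ B y (EuclideanSpace.single 0 1) = v t y 2 * fderiv ℝ (ψ t) y (EuclideanSpace.single 0 1)) ∧
      (∀ y, fderiv ℝ B y (EuclideanSpace.single 1 1) = v t y 2 * fderiv ℝ (ψ t) y (EuclideanSpace.single 1 1)) ∧
      ∀ y, fderiv ℝ (fun z => deriv (fun s => ψ s z) t + (convect (v t) (ψ t) z - (Δ (ψ t)) z) -
            (v t z 2 * fderiv ℝ (ψ t) z (EuclideanSpace.single 2 1) - fderiv ℝ B z (EuclideanSpace.single 2 1))) y
          (EuclideanSpace.single 1 1) = 0 ∧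
        fderiv ℝ (fun z => deriv (fun s => ψ s z) t + (convect (v t) (ψ t) z - (Δ (ψ t)) z) -
            (v t z 2 * fderiv ℝ (ψ t) z (EuclideanSpace.single 2 1) - fderiv ℝ B z (EuclideanSpace.single 2 1))) y
          (EuclideanSpace.single 0 1) = 0 := by
  have hsm : ContDiffOn ℝ ∞ (uncurry v) (Iio (0 : ℝ) ×ˢ univ) :=
    (analyticOnNhd_uncurry hcont (bdd_of_hasTypeITimeDecay hrate) hmild).contDiffOn_of_completeSpace
  have hS : UniqueDiffOn ℝ (Iio (0 : ℝ)) := isOpen_Iio.uniqueDiffOn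
  have hV : ContDiff ℝ ∞ (v t) := IsSmoothSpaceTimeOn.contDiff_slice hsm ht
  have hc2 : ∀ z, curl (v t) z 2 = 0 := fun z => curl_two_eq_zero hpol ht z
  have hφt : φ t = fun x : EuclideanSpace ℝ (Fin 3) =>
      ∫ σ in (0 : ℝ)..1, ⟪v t (σ • (x - x 2 • (EuclideanSpace.single (2 : Fin 3) (1 : ℝ))) +
        x 2 • (EuclideanSpace.single (2 : Fin 3) (1 : ℝ))), x - x 2 • (EuclideanSpace.single (2 : Fin 3) (1 : ℝ))⟫_ℝ := by
    rw [hφ]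
  have hψt : ψ t = fun z => v t z 2 - fderiv ℝ (φ t) z (EuclideanSpace.single 2 1) := by rw [hψ]
  have hψsl : ContDiff ℝ ∞ (ψ t) := by rw [hψt]; exact contDiff_stream hV hφt
  have hg : ContDiff ℝ ∞ fun z => v t z 2 :=
    (EuclideanSpace.proj (2 : Fin 3) : EuclideanSpace ℝ (Fin 3) →L[ℝ] ℝ).contDiff.comp hV
  -- the frozen bracket for the explicit stream function
  have hcomp : ∀ z, curl (v t) z 0 = fderiv ℝ (ψ t) z (EuclideanSpace.single 1 1) ∧
      curl (v t) z 1 = -fderiv ℝ (ψ t) z (EuclideanSpace.single 0 1) ∧ curl (v t) z 2 = 0 := by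
    intro z; rw [hψt]; exact curl_apply_eq_fderiv_stream hV hc2 hφt z
  have hbr : ∀ y, fderiv ℝ (ψ t) y (EuclideanSpace.single 1 1) * fderiv ℝ (fun z => v t z 2) y (EuclideanSpace.single 0 1) -
      fderiv ℝ (ψ t) y (EuclideanSpace.single 0 1) * fderiv ℝ (fun z => v t z 2) y (EuclideanSpace.single 1 1) = 0 := by
    intro y
    rw [fderiv_apply_coord hV, fderiv_apply_coord hV]
    exact frozen_bracket (hfi t ht) hcomp y
  obtain ⟨B, hB, hB0, hB1⟩ := exists_potential_of_bracket_eq_zero hg hψsl hbr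
  obtain hT := fun y => clebsch_T_equation hrate hcont hmild hdiv hpol hφ hψ ht y
  refine ⟨B, hB, hB0, hB1, fun y => ?_⟩
  have hW := fun (i : Fin 3) (hi : i = 0 ∨ i = 1) => fderiv_weight_mul_sub_apply hg hψsl hB hB0 hB1 y hi
  -- differentiability of the two groups
  have hψs : IsSmoothSpaceTimeOn (Iio (0 : ℝ)) ψ := by
    have hφs : IsSmoothSpaceTimeOn (Iio (0 : ℝ)) φ := by rw [hφ]; exact contDiffOn_linePotential_uncurry hsm
    have h1 : ContDiffOn ℝ ∞ (fun q : ℝ × EuclideanSpace ℝ (Fin 3) => (uncurry v) q 2) (Iio (0 : ℝ) ×ˢ univ) :=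
      (EuclideanSpace.proj (2 : Fin 3) : EuclideanSpace ℝ (Fin 3) →L[ℝ] ℝ).contDiff.comp_contDiffOn hsm
    have h2 : ContDiffOn ℝ ∞ (fun q : ℝ × EuclideanSpace ℝ (Fin 3) =>
        (uncurry (fun t x => fderiv ℝ (φ t) x)) q (EuclideanSpace.single 2 1)) (Iio (0 : ℝ) ×ˢ univ) :=
      ContDiffOn.clm_apply (show ContDiffOn ℝ ∞ (uncurry fun t x => fderiv ℝ (φ t) x)
        (Iio (0 : ℝ) ×ˢ univ) from hφs.fderiv_slice hS) contDiffOn_const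
    rw [hψ]
    exact (h1.sub h2).congr fun q _ => by rcases q with ⟨s, z⟩; rfl
  have hTd : DifferentiableAt ℝ (fun z => deriv (fun s => ψ s z) t + (convect (v t) (ψ t) z - (Δ (ψ t)) z)) y := by
    have h := (IsSmoothSpaceTimeOn.timeDerivWithin hψs hS).contDiff_slice ht
    have e : timeDerivWithin (Iio (0 : ℝ)) ψ t = fun z => deriv (fun s => ψ s z) t := by
      funext z; rw [timeDerivWithin_apply, derivWithin_of_isOpen isOpen_Iio ht]
    rw [e] at h
    have hdc : ContDiff ℝ ∞ fun z => convect (v t) (ψ t) z := (hψsl.fderiv_right (m := ∞) le_rfl).clm_apply hV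
    have hdl : ContDiff ℝ (1 : ℕ∞) (Δ (ψ t)) := contDiff_laplacian (n := 1) (hψsl.of_le (by norm_cast))
    exact ((h.differentiable (by simp)) y).add
      (((hdc.differentiable (by simp)) y).sub ((hdl.differentiable (by simp)) y))
  have hSd : DifferentiableAt ℝ (fun z => v t z 2 * fderiv ℝ (ψ t) z (EuclideanSpace.single 2 1) -
      fderiv ℝ B z (EuclideanSpace.single 2 1)) y := by
    have hd2 : ContDiff ℝ ∞ fun z => fderiv ℝ (ψ t) z (EuclideanSpace.single 2 1) :=
      (hψsl.fderiv_right (m := ∞) le_rfl).clm_apply contDiff_const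
    have hB2 : ContDiff ℝ ∞ fun z => fderiv ℝ B z (EuclideanSpace.single 2 1) :=
      (hB.fderiv_right (m := ∞) le_rfl).clm_apply contDiff_const
    exact (((hg.mul hd2).sub hB2).differentiable (by simp)) y
  have hg2 : ∀ u, fderiv ℝ (fun z => v t z 2) y u = fderiv ℝ (v t) y u 2 := fun u => fderiv_apply_coord hV y u 2
  obtain ⟨hT1, hT0⟩ := hT y
  refine ⟨?_, ?_⟩
  · rw [fderiv_fun_sub hTd hSd, _root_.sub_apply, hT1, hW 1 (Or.inr rfl), hg2, hg2]; ring
  · rw [fderiv_fun_sub hTd hSd, _root_.sub_apply, hT0, hW 0 (Or.inl rfl), hg2, hg2]; ring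


end Summit.NavierStokesRegularity.NavierStokesRegularity.Theorems.PoloidalWindowDoorPoloidalWindowRigidityClebschPsiEquation

end
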